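import Summits.ResolutionOfSingularities.ResolutionOfSingularities.Theorems.FrobeniusLadderFInjectiveMacaulayficationFHalfRowOfProductCentre
import Summits.ResolutionOfSingularities.ResolutionOfSingularities.Theorems.FrobeniusLadderFInjectiveMacaulayficationLx6q7d5PointKBlowupFull
import Summits.ResolutionOfSingularities.ResolutionOfSingularities.Theorems.FrobeniusLadderFInjectiveMacaulayficationLx6q7d5PointFloor
import HarnessLib

/-!
# THE K-TT-a POINT FLOOR OF d5lx6q7 IS CURED BY ONE FIBRE-SUPPORTED BLOWING UP — and the TWO-SIDED ROW `f5pos_row_two` = ⟨legal, not full, cured⟩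
# (crux `FInjectiveMacaulayfication` stmt-ResolutionOfSingularities-15315, chain w45a; res-L1-w45a-plan-1 RULING R19.20 (same method on the d = 5 looping bed); seat res-L1-w45a-stub-2 g9; input side = res-L1-w45a-lead-1 g9's ✓ p640799 `Lx6q7d5PointFloor.pointFloor_lx6q7d5_input_legal` /
# `pointFloor_lx6q7d5_not_full`; cure = this seat's own 𝔪·K product certificate 1646cc7dae5c4e56 via ✓ `Lx6q7d5PointKBlowupFull.hrow_lx6q7d5`)

[OURS · L1 W4.5a] Support file (`--supports stmt-ResolutionOfSingularities-15315 --as helper`); def-free, unconditional; replaces the role of NO printed item;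
NOT a statement of the manuscript; AI-written (AI review is weaker than expert review).

`X = Spec (k[X₀..X₅]/(f))`, `f = X4 ^ 2 + X0 ^ 6 * X4 + X1 ^ 3 + X2 ^ 3 + X3 ^ 7` (d5lx6q7: `z² + x⁶z + y³ + u³ + v³ + t⁷`, res-L1-w45a-idea-1 FB5-r7's bed on which the rad-τ
recipe of record is PERIODIC from the point floor — RULING R19.16, `TauTowerConjecture` refuted by evidence), `char k = 2` (any field), `v` = the vertex (isolated singular point),
floor centre `𝔪 = (x̄, ȳ, ū, v̄, t̄, z̄)`. THEN (§1 `pointFloor_lx6q7d5_row`): for EVERY blowing up `g : S′ → Spec 𝒪_{X,v}` along `𝔪·𝒪_{X,v}` there is `𝓚 ≠ ⊥` on `S′`, supported over the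
closed point, ALL of whose blowings up are FULL at every stalk — ONE term on res-L1-w45a-stub-3's generic `FHalfRowOfProductCentre.fHalfConclusion_of_affineBlowup_mul`
(p618085 §2) over `Lx6q7d5PointKBlowupFull.hrow_lx6q7d5` (the blow-up of `X` along `𝔪·K` is FULL at every point: 52-chart fan found by search, thin Fedder cells everywhere,
`K` = 235 monomials from a strictly concave support function). §2 `f5pos_row_two` conjoins it with res-L1-w45a-lead-1's input legality and non-FULLness (p640799):
LEGAL ∧ NOT F(5)-iso ∧ CURED for the refuting floor — «the rad-τ tower from this floor never FULL-ifies (evidence), yet ONE fibre-supported blow-up does (kernel)».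
[OURS · certificate instance + assembly of landed theorems] [cite: StacksProject, Tag 080A] [cite: GortzWedhorn2020, Prop. 13.92]
-/

-- single-problem summit: the doubled namespace component is forced
set_option linter.dupNamespace false

noncomputable section

open AlgebraicGeometry CategoryTheory Literature.AlgebraicGeometry.Resolution TopologicalSpace IsLocalRing MvPolynomial

namespace Summit.ResolutionOfSingularities.ResolutionOfSingularities.Theorems.FInjectiveMacaulayfication.Lx6q7d5PointFloorRow

open Summit.ResolutionOfSingularities.ResolutionOfSingularities.Theorems.FInjectiveMacaulayfication
open SliceableCentre

/-! ## §1 The cure -/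

/-- ★★★ **THE d5lx6q7 POINT FLOOR IS CURED, UNCONDITIONAL.** See the module docstring. [OURS · certificate instance] [cite: StacksProject, Tag 080A] -/
theorem pointFloor_lx6q7d5_row (k : Type) [Field k] [CharP k 2] (f : MvPolynomial (Fin 6) k)
    (hf : f = X 5 ^ 2 + X 0 ^ 6 * X 5 + X 1 ^ 3 + X 2 ^ 3 + X 3 ^ 3 + X 4 ^ 7)
    (v : Spec (.of (MvPolynomial (Fin 6) k ⧸ Ideal.span {f})))
    (hv : v.asIdeal = Ideal.span (Set.range (fun j : Fin 6 => Ideal.Quotient.mk (Ideal.span {f}) (X j)))) :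
    ∀ (S' : Scheme.{0}) (g : S' ⟶ Spec ((Spec (.of (MvPolynomial (Fin 6) k ⧸ Ideal.span {f}))).presheaf.stalk v)),
      IsBlowup g ((affineBlowup.idealSheaf (Ideal.span (Set.range (fun j : Fin 6 => Ideal.Quotient.mk (Ideal.span {f}) (X j))))).comap
        ((Spec (.of (MvPolynomial (Fin 6) k ⧸ Ideal.span {f}))).fromSpecStalk v)) →
      ∃ 𝓚 : S'.IdealSheafData, 𝓚 ≠ ⊥ ∧
        (∀ s ∈ (𝓚.support : Set S'), g.base s = closedPoint ((Spec (.of (MvPolynomial (Fin 6) k ⧸ Ideal.span {f}))).presheaf.stalk v)) ∧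
        ∀ (S'' : Scheme.{0}) (π : S'' ⟶ S'), IsBlowup π 𝓚 → ∀ s : S'', FullCl 2 (S''.presheaf.stalk s) := by
  haveI hp : (Ideal.span {f}).IsPrime :=
    (Ideal.span_singleton_prime (Lx6q7d5Specimen.prime_f k f hf).ne_zero).mpr (Lx6q7d5Specimen.prime_f k f hf)
  haveI : IsDomain (MvPolynomial (Fin 6) k ⧸ Ideal.span {f}) := Ideal.Quotient.isDomain _
  exact FHalfRowOfProductCentre.fHalfConclusion_of_affineBlowup_mul 2 _ _ (Lx6q7d5PointKBlowupFull.span_floor_ne_bot k f hf)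
    (Lx6q7d5PointKBlowupFull.span_KA_ne_bot k f hf) v (by rw [hv]; exact Lx6q7d5PointKBlowupFull.span_range_X_le_radical_span_KA k f)
    (Lx6q7d5PointKBlowupFull.hrow_lx6q7d5 k f hf)

/-! ## §2 The two-sided row -/

/-- ★★★ **d = 5 ROW #2 (the d5lx6q7 POINT FLOOR — the K-TT-a refuting floor) AS ONE KERNEL THEOREM: LEGAL ∧ NOT F(5)-iso ∧ CURED.** For every blowing up
`g : S′ → Spec 𝒪_{X,v}` along `I = 𝔪̃|_{Spec 𝒪_{X,v}}`: (legal, res-L1-w45a-lead-1 ✓ p640799) `I ≠ ⊥`, `Supp I ⊆ (Reg)ᶜ`, `S′` regular off the closed fibre and CM everywhere;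
(NOT F(5)-iso, p640799) some stalk of `S′` over the closed point is NOT FULL; (cured, §1) there is `𝓚 ≠ ⊥` on `S′`, supported over the closed point, ALL of whose blowings
up are FULL at every stalk. [OURS · assembly of landed theorems] -/
theorem f5pos_row_two (k : Type) [Field k] [CharP k 2] (f : MvPolynomial (Fin 6) k) (hf : f = X 5 ^ 2 + X 0 ^ 6 * X 5 + X 1 ^ 3 + X 2 ^ 3 + X 3 ^ 3 + X 4 ^ 7)
    (v : Spec (.of (MvPolynomial (Fin 6) k ⧸ Ideal.span {f})))
    (hv : v.asIdeal = Ideal.span (Set.range (fun j : Fin 6 => Ideal.Quotient.mk (Ideal.span {f}) (X j))))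
    (S' : Scheme.{0}) (g : S' ⟶ Spec ((Spec (.of (MvPolynomial (Fin 6) k ⧸ Ideal.span {f}))).presheaf.stalk v))
    (hg : IsBlowup g ((affineBlowup.idealSheaf (Ideal.span (Set.range (fun j : Fin 6 => Ideal.Quotient.mk (Ideal.span {f}) (X j))))).comap
      ((Spec (.of (MvPolynomial (Fin 6) k ⧸ Ideal.span {f}))).fromSpecStalk v))) :
    (((affineBlowup.idealSheaf (Ideal.span (Set.range (fun j : Fin 6 => Ideal.Quotient.mk (Ideal.span {f}) (X j))))).comap
        ((Spec (.of (MvPolynomial (Fin 6) k ⧸ Ideal.span {f}))).fromSpecStalk v)) ≠ ⊥ ∧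
      (((((affineBlowup.idealSheaf (Ideal.span (Set.range (fun j : Fin 6 => Ideal.Quotient.mk (Ideal.span {f}) (X j))))).comap
        ((Spec (.of (MvPolynomial (Fin 6) k ⧸ Ideal.span {f}))).fromSpecStalk v))).support :
          Set (Spec ((Spec (.of (MvPolynomial (Fin 6) k ⧸ Ideal.span {f}))).presheaf.stalk v))) ⊆
        (Scheme.regularLocus (Spec ((Spec (.of (MvPolynomial (Fin 6) k ⧸ Ideal.span {f}))).presheaf.stalk v)))ᶜ) ∧
      (∀ s : S', g.base s ≠ closedPoint ((Spec (.of (MvPolynomial (Fin 6) k ⧸ Ideal.span {f}))).presheaf.stalk v) → s ∈ Scheme.regularLocus S') ∧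
      (∀ s : S', CMCl (S'.presheaf.stalk s))) ∧
    (∃ s : S', g.base s = closedPoint ((Spec (.of (MvPolynomial (Fin 6) k ⧸ Ideal.span {f}))).presheaf.stalk v) ∧ ¬ FullCl 2 (S'.presheaf.stalk s)) ∧
    (∃ 𝓚 : S'.IdealSheafData, 𝓚 ≠ ⊥ ∧
      (∀ s ∈ (𝓚.support : Set S'), g.base s = closedPoint ((Spec (.of (MvPolynomial (Fin 6) k ⧸ Ideal.span {f}))).presheaf.stalk v)) ∧
      ∀ (S'' : Scheme.{0}) (π : S'' ⟶ S'), IsBlowup π 𝓚 → ∀ s : S'', FullCl 2 (S''.presheaf.stalk s)) :=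
  ⟨Lx6q7d5PointFloor.pointFloor_lx6q7d5_input_legal k f hf v hv S' g hg, Lx6q7d5PointFloor.pointFloor_lx6q7d5_not_full k f hf v hv S' g hg,
    pointFloor_lx6q7d5_row k f hf v hv S' g hg⟩

end Summit.ResolutionOfSingularities.ResolutionOfSingularities.Theorems.FInjectiveMacaulayfication.Lx6q7d5PointFloorRow

end
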